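/-
COR-CM (cells pub-hodgecm / pub-hodgecm2, stage 2 of the Hodge ladder) — TRANSPOSITION item (vi), X3-Char ∕ X3-ω ∕ Δ2 bridge supply:
THE LIU REST AT AN ARBITRARY `μ`, AN ARBITRARY FRAME, AN ARBITRARY FAITHFUL REPRESENTATIVE SECTION OF THE COLLECTIONS, AND AN EXPLICIT
ε-NORMALISER `δ′`.  Sequel of `Transposition/Item6RestOfChar.lean` (`restOfCharD`): there the Def. 4.11 carrier `ω(μ, ε, χ)` is
`Def411WeilCarriers.omega`, realised on the line `⟨lineOf ε⟩` CHOSEN by the tree, and Def. 4.12's «collection of `e`» is `epsOf … (imagUnit F) e`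
= the local classes of `e/δ_F`.  The Δ2 bridge at the pinned dictionary must identify `ω(μ, ε, χ)` with the package's Weil module on ITS OWN line of
the same collection (X3-ω pin `e`), so (i) the carrier is taken at a faithful representative section `r : Def411WeilCarriers.Rep F⁺ (δ²)` of the
collections (`Literature/…/Liu2021/Def411WeilCarriersAtLine.lean`: `omegaAtLine … (r.toFun ε) χ`, `locF (r.toFun ε) = ε` on global `ε`), which a
consumer re-points (`Rep.update …`), and (ii) the ε-NORMALISER `δ′ ∈ F^{×−}` of Def. 4.12's first bullet («`ε_v = e·Nm_{E_v/F_v}E_v^×`», read in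
`Eps F⁺ (δ_F²) = Π_v F⁺_v^×/Nm` as the classes of `e/δ′`, `Def411WeilCarriers.epsOf … δ′`) is an EXPLICIT PARAMETER, because it IS the model's
dictionary «collection of `e` ↦ hermitian line `⟨e/δ′⟩`» and its orientation decides which collections are `μ`-admissible AT WHICH LINE
(item6-p3 g13 memo `X3-OMEGA-SIGN`: with `Φ_μ = Φ^δ(a)` the admissible `e` lie in `δ̄_F·a·(F⁺)_{≫0}`; a normaliser anti-oriented to `δ_F`
— `δ̄_F = −δ_F`, or `(2δ_F)⁻¹`, the exact match of the lane's symplectic form `im h`, `Tr_{F/F⁺}(δ_F z) = 2d·im z`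
(`UnitaryGroupSymplecticEmbedding.trace_delta_mul`) — puts them on `⟨a⟩`; the tree's `δ_F` puts them on `⟨−a·q⟩`).  At `δ′ := imagUnit F`,
`r := Rep.ofLineOf` this is `restOfCharD` (`restOfCharRep_ofLineOf`, `rfl`).  The five Liu-side readings come once for all `(δ′, r, μ)` (they never
read `epsOf`).  Seats prover-pub-hodgecm2-item6-p3-g12-0 ∕ -g13-0 (item6-p3 gens 12–13, item-(vi) lineage).  ONE data def + theorems; no named fact,
no instance, no `variable` (every binder explicit, the named fact `h` included); nothing landed is edited or restated.  HC_CM is NOT proved;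
«Δ2 BRIDGE CLOSED» is NOT claimed; `h21`, `hD1` are hypotheses of two theorems; which `δ′` is [Liu2021] AS PRINTED is a displayed convention of the
consumer's cite, not decided here; no pointer moves.
-/
import Summits.HodgeConjecture.CorCM.B01.Transposition.Item6RestOfChar
import Literature.NumberTheory.Automorphic.Liu2021.Def411WeilCarriersAtLine
import HarnessLib

set_option autoImplicit false

/-!
# `Model.restOfCharRep … e dV hdV hdV0 ιV δ′ r μ hμ hw` — the Liu rest at `(μ, frame, normaliser, representative section)`, with its readings

* `Model.restOfCharRep` — `restOne` over `sec42DataOf h isoOf F ι₁ V Φ` with Def. 4.5 carriers `Carriers.ofPolDR μ …`, Def. 4.11 ∕ 4.12 carriers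
  `Eps ∕ epsOf … δ′ ∕ Chi`, and `omega ε χ := omegaAtLine … (hsChiD … (toHeckeCharacter F μ) …) (r.toFun ε) χ`, `rho` likewise through `ιV`;
* `Model.restOfCharRep_ofLineOf` — at `δ′ := imagUnit F`, `r := Rep.ofLineOf` it is `restOfCharD` (`rfl`);
* readings: `nonempty_obj_restOfCharRep (h21)`, `nonempty_chi_restOfCharRep`, `rhoAt_restOfCharRep_smooth (hιc)`,
  `rhoAt_restOfCharRep_isIrreducible_of_lemD1AsPrinted (hιs) (hn) (i) (hD1)`, `nontrivial_omegaAt_restOfCharRep_of_lemD1AsPrinted`.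

HC_CM is NOT proved.
-/

noncomputable section

open scoped TensorProduct InnerProductSpace Kronecker Matrix

namespace Summit.HodgeConjecture.CorCM.Model

open CategoryTheory CategoryTheory.Limits AlgebraicGeometry NumberField IsDedekindDomain
open Literature.AlgebraicGeometry.Motives
open Literature.AlgebraicGeometry.HodgeTheory
open Literature.AlgebraicGeometry.ShimuraVarieties
open Literature.AlgebraicGeometry.ShimuraVarieties.UnitaryCanonicalModel
open Literature.AlgebraicGeometry.ComplexMultiplication (IsCMTypeRealisation)
open Literature.NumberTheory.ComplexMultiplication
open Literature.NumberTheory.Automorphic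
open Literature.NumberTheory.Automorphic.UnitaryGroup (localCharOfCenter)
open Literature.NumberTheory.Automorphic.IdeleClassGroup
open Literature.NumberTheory.Automorphic.PicardCM
open Literature.NumberTheory.Automorphic.Liu2021
open Literature.NumberTheory.Automorphic.Liu2021.AppendixC
open Literature.NumberTheory.Automorphic.Liu2021.AppendixC.RestOne
open Literature.NumberTheory.Automorphic.Liu2021.Def411WeilCarriers (JW TW isSymm_TW isUnit_det_TW JW_eq JW_apply_ne_zero lineOf Rep
  omegaAtLine rhoAtLine)
open Literature.NumberTheory.GelbartRogawski1991 Literature.NumberTheory.GelbartRogawski1991.UnitaryDualPair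
open Literature.NumberTheory.GelbartRogawski1991.UnitaryDualPair.WeilCoinv
open Literature.NumberTheory.GelbartRogawski1991.UnitaryDualPair.LocalSplitting (localMu norm_localMu continuous_localMu localMu_toLocalRing_eq_one_iff)
open Literature.NumberTheory.Weil1964 Literature.RepresentationTheory
open Literature.RepresentationTheory.Liu2021
open Summit.HodgeConjecture.CorCM.Transposition

section Rep

set_option maxHeartbeats 1000000 in
-- (one `restOne` application; the ω-arguments carry the `splittingDatum` telescope, as in `restOfCharD`)
/-- **The Liu rest at `(μ, frame, normaliser, representative section)`**: [Liu2021] Def. 4.5 (2) ∕ 4.11 ∕ 4.16 carriers over the constructed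
§4.2 datum; Def. 4.12's «collection of `e ∈ E^{×−}`» read as the local classes of `e/δ′` (`epsOf … δ′`, the ε-NORMALISER `δ′`, a parameter —
module docstring); the oscillator `ω(μ, ε, χ)` REALISED ON THE LINE `⟨r ε⟩` of a faithful representative section `r` of the collections
(`omegaAtLine`; Def. 4.11's `⊗'_v ω(μ_v, ε_v, χ_v)` is built from the nonarchimedean local data of `ε` alone, and `⟨r ε⟩` has local norm classes
`ε`: `r.locF_toFun`), at the splitting family attached to `toHeckeCharacter F μ` over the frame `(e, dV)`, pulled back along `ιV`.
[cite: Liu2021, Def. 4.5 (2) (FJcycle.tex l. 1944–1958), Def. 4.11 (l. 2088–2096), Def. 4.12 (l. 2102–2108), Def. 4.16 (l. 2219), App. D §D.1 Steps 1–2 (l. 5215–5219)]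
[cite: GelbartRogawski1991, §3.1 Prop. 3.1.1 p. 455 L1–3] -/
def restOfCharRep (h : exists_recordSystem) (F : CMField) [IsGalois ℚ F] (h6 : 6 ≤ Module.finrank ℚ F)
    (ι₁ : F →+* ℂ) (V : HermSpace3 F ι₁) (Φ : CMType F) {n : ℕ} (e : Fin 3 × Fin 1 ≃ Fin n) (dV : Fin 3 → F)
    (hdV : ∀ i, IsCMField.complexConj F (dV i) = dV i) (hdV0 : ∀ i, dV i ≠ 0)
    (ιV : (sec42DataOf h isoOf F ι₁ V Φ).G →*
      UnitaryGroup.finAdelic ↥(maximalRealSubfield F) F (IsCMField.complexConj F) 3 (Matrix.diagonal dV))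
    (δ' : F) (r : Rep ↥(maximalRealSubfield F) (imagUnitSq F))
    (μ : IdeleClassGroup F →ₜ* Circle) (hμ : IdeleClassGroup.IsConjugateSymplectic F μ) (hw : IdeleClassGroup.HasWeight F μ 1) :
    Thm418Rest (sec42DataOf h isoOf F ι₁ V Φ) :=
  restOne (sec42DataOf h isoOf F ι₁ V Φ) (AlgHom.id ℚ F) ι₁ hμ hw
    (Def45.Carriers.ofPolDR μ (Def45.PolDR ι₁ hμ (Def45.RMuForm ι₁ hμ)))
    (Def411WeilCarriers.Eps ↥(maximalRealSubfield F) (imagUnitSq F))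
    (Def411WeilCarriers.epsOf ↥(maximalRealSubfield F) (imagUnitSq F) F δ')
    (Def411WeilCarriers.Chi ↥(maximalRealSubfield F) F (IsCMField.complexConj F))
    (fun ε χ => omegaAtLine ↥(maximalRealSubfield F) F (IsCMField.complexConj F) 3 e (Matrix.diagonal dV)
      (complexConj_imagUnit F) (imagUnit_ne_zero F) (imagUnit_mul_self F) (realDiagonal_isSymm F dV hdV)
      (isUnit_det_realDiagonal F dV hdV hdV0) (realDiagonal_map F dV hdV).symm
      (OmegaChiSplitting.hsChiD F e dV hdV hdV0 (toHeckeCharacter F μ) (isUnitary_toHeckeCharacter F μ)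
        ((isOscillatorChar_toHeckeCharacter_iff μ).mpr hμ)) (r.toFun ε) χ)
    (fun ε χ => rhoAtLine ↥(maximalRealSubfield F) F (IsCMField.complexConj F) 3 e (Matrix.diagonal dV)
      (complexConj_imagUnit F) (imagUnit_ne_zero F) (imagUnit_mul_self F) (realDiagonal_isSymm F dV hdV)
      (isUnit_det_realDiagonal F dV hdV hdV0) (realDiagonal_map F dV hdV).symm
      (OmegaChiSplitting.hsChiD F e dV hdV hdV0 (toHeckeCharacter F μ) (isUnitary_toHeckeCharacter F μ)
        ((isOscillatorChar_toHeckeCharacter_iff μ).mpr hμ)) ιV (r.toFun ε) χ)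
    ((heckeTranslatesFamilyOf heckeTranslate_definedOver_holds h isoOf F ι₁ V Φ h6).rhoΩOne (AlgHom.id ℚ F) ι₁ hμ hw
      (Def45.Carriers.ofPolDR μ (Def45.PolDR ι₁ hμ (Def45.RMuForm ι₁ hμ))))

/-- at the tree's own choices `δ′ := imagUnit F`, `r := Rep.ofLineOf` the representative rest IS `restOfCharD` (definitional:
`omega … ε χ = omegaAtLine … (lineOf ε) χ`, `epsOf … (imagUnit F)`). [folklore] -/
theorem restOfCharRep_ofLineOf (h : exists_recordSystem) (F : CMField) [IsGalois ℚ F] (h6 : 6 ≤ Module.finrank ℚ F)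
    (ι₁ : F →+* ℂ) (V : HermSpace3 F ι₁) (Φ : CMType F) {n : ℕ} (e : Fin 3 × Fin 1 ≃ Fin n) (dV : Fin 3 → F)
    (hdV : ∀ i, IsCMField.complexConj F (dV i) = dV i) (hdV0 : ∀ i, dV i ≠ 0)
    (ιV : (sec42DataOf h isoOf F ι₁ V Φ).G →*
      UnitaryGroup.finAdelic ↥(maximalRealSubfield F) F (IsCMField.complexConj F) 3 (Matrix.diagonal dV))
    (μ : IdeleClassGroup F →ₜ* Circle) (hμ : IdeleClassGroup.IsConjugateSymplectic F μ) (hw : IdeleClassGroup.HasWeight F μ 1) :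
    restOfCharRep h F h6 ι₁ V Φ e dV hdV hdV0 ιV (imagUnit F) (Rep.ofLineOf ↥(maximalRealSubfield F) (imagUnitSq F)) μ hμ hw =
      restOfCharD h F h6 ι₁ V Φ e dV hdV hdV0 ιV μ hμ hw :=
  rfl

/-- **`𝒜(μ) ≠ ∅`** at the representative rest, from `h21` ([Shimura1998] Thm. 21.4; `Def45.nonempty_cmDatum_polDR_rMuForm_of_casselman`).
[cite: Liu2021, Prop. 4.6 (1) (FJcycle.tex l. 1969)] [cite: Shimura1998, §21.4 Thm. 21.4] -/
theorem nonempty_obj_restOfCharRep (h : exists_recordSystem) (F : CMField) [IsGalois ℚ F] (h6 : 6 ≤ Module.finrank ℚ F)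
    (ι₁ : F →+* ℂ) (V : HermSpace3 F ι₁) (Φ : CMType F) {n : ℕ} (e : Fin 3 × Fin 1 ≃ Fin n) (dV : Fin 3 → F)
    (hdV : ∀ i, IsCMField.complexConj F (dV i) = dV i) (hdV0 : ∀ i, dV i ≠ 0)
    (ιV : (sec42DataOf h isoOf F ι₁ V Φ).G →*
      UnitaryGroup.finAdelic ↥(maximalRealSubfield F) F (IsCMField.complexConj F) 3 (Matrix.diagonal dV))
    (δ' : F) (r : Rep ↥(maximalRealSubfield F) (imagUnitSq F))
    (μ : IdeleClassGroup F →ₜ* Circle) (hμ : IdeleClassGroup.IsConjugateSymplectic F μ) (hw : IdeleClassGroup.HasWeight F μ 1)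
    (h21 : shimura1998_thm21_4_casselman) :
    Nonempty (toThm418Data (sec42DataOf h isoOf F ι₁ V Φ) (restOfCharRep h F h6 ι₁ V Φ e dV hdV hdV0 ιV δ' r μ hμ hw)).Obj := by
  unfold restOfCharRep
  exact (nonempty_obj_restOne_iff _ _ _ _ _ _ _ _ _ _ _ _).mpr
    (Def45.nonempty_cmDatum_polDR_rMuForm_of_casselman (σ := ι₁) (hμ := hμ) hw h21)

/-- a character exists at the representative rest (`Def411WeilCarriers.nonempty_chi`). [cite: Liu2021, Def. 4.11 (FJcycle.tex l. 2090)] -/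
theorem nonempty_chi_restOfCharRep (h : exists_recordSystem) (F : CMField) [IsGalois ℚ F] (h6 : 6 ≤ Module.finrank ℚ F)
    (ι₁ : F →+* ℂ) (V : HermSpace3 F ι₁) (Φ : CMType F) {n : ℕ} (e : Fin 3 × Fin 1 ≃ Fin n) (dV : Fin 3 → F)
    (hdV : ∀ i, IsCMField.complexConj F (dV i) = dV i) (hdV0 : ∀ i, dV i ≠ 0)
    (ιV : (sec42DataOf h isoOf F ι₁ V Φ).G →*
      UnitaryGroup.finAdelic ↥(maximalRealSubfield F) F (IsCMField.complexConj F) 3 (Matrix.diagonal dV))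
    (δ' : F) (r : Rep ↥(maximalRealSubfield F) (imagUnitSq F))
    (μ : IdeleClassGroup F →ₜ* Circle) (hμ : IdeleClassGroup.IsConjugateSymplectic F μ) (hw : IdeleClassGroup.HasWeight F μ 1) :
    Nonempty (toThm418Data (sec42DataOf h isoOf F ι₁ V Φ) (restOfCharRep h F h6 ι₁ V Φ e dV hdV hdV0 ιV δ' r μ hμ hw)).Chi :=
  Def411WeilCarriers.nonempty_chi ↥(maximalRealSubfield F) F (IsCMField.complexConj F)

/-- **smoothness** at the representative rest (`rhoAtLine_smooth` + `hscChiD`, `ιV` continuous). [cite: Liu2021, Def. 4.11 (FJcycle.tex l. 2094–2096)] -/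
theorem rhoAt_restOfCharRep_smooth (h : exists_recordSystem) (F : CMField) [IsGalois ℚ F] (h6 : 6 ≤ Module.finrank ℚ F)
    (ι₁ : F →+* ℂ) (V : HermSpace3 F ι₁) (Φ : CMType F) {n : ℕ} (e : Fin 3 × Fin 1 ≃ Fin n) (dV : Fin 3 → F)
    (hdV : ∀ i, IsCMField.complexConj F (dV i) = dV i) (hdV0 : ∀ i, dV i ≠ 0)
    (ιV : (sec42DataOf h isoOf F ι₁ V Φ).G →*
      UnitaryGroup.finAdelic ↥(maximalRealSubfield F) F (IsCMField.complexConj F) 3 (Matrix.diagonal dV))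
    (δ' : F) (r : Rep ↥(maximalRealSubfield F) (imagUnitSq F))
    (μ : IdeleClassGroup F →ₜ* Circle) (hμ : IdeleClassGroup.IsConjugateSymplectic F μ) (hw : IdeleClassGroup.HasWeight F μ 1) (hιc : Continuous ιV)
    (i : (toThm418Data (sec42DataOf h isoOf F ι₁ V Φ) (restOfCharRep h F h6 ι₁ V Φ e dV hdV hdV0 ιV δ' r μ hμ hw)).AdmIndex)
    (v : (toThm418Data (sec42DataOf h isoOf F ι₁ V Φ) (restOfCharRep h F h6 ι₁ V Φ e dV hdV hdV0 ιV δ' r μ hμ hw)).omegaAt i) :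
    ∃ S : Subgroup (sec42DataOf h isoOf F ι₁ V Φ).G, IsOpen (S : Set (sec42DataOf h isoOf F ι₁ V Φ).G) ∧
      ∀ k ∈ S, (toThm418Data (sec42DataOf h isoOf F ι₁ V Φ) (restOfCharRep h F h6 ι₁ V Φ e dV hdV hdV0 ιV δ' r μ hμ hw)).rhoAt i k v = v :=
  Def411WeilCarriers.rhoAtLine_smooth ↥(maximalRealSubfield F) F (IsCMField.complexConj F) 3 e (Matrix.diagonal dV)
    (complexConj_imagUnit F) (imagUnit_ne_zero F) (imagUnit_mul_self F) (realDiagonal_isSymm F dV hdV)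
    (isUnit_det_realDiagonal F dV hdV hdV0) (realDiagonal_map F dV hdV).symm
    (OmegaChiSplitting.hsChiD F e dV hdV hdV0 (toHeckeCharacter F μ) (isUnitary_toHeckeCharacter F μ)
      ((isOscillatorChar_toHeckeCharacter_iff μ).mpr hμ))
    ιV hιc
    (OmegaChiSplitting.hscChiD F e dV hdV hdV0 (toHeckeCharacter F μ) (isUnitary_toHeckeCharacter F μ)
      ((isOscillatorChar_toHeckeCharacter_iff μ).mpr hμ)) (r.toFun i.1.1) i.1.2 v

/-- **irreducibility** at the representative rest, from [Liu2021, App. D Lemma D.1 (1)] AS PRINTED per place at the `μ`-attached local data ON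
THE LINE `⟨r ε⟩` (`chiLocalSplittingsD … (r.toFun ε)`, `localMu F (toHeckeCharacter F μ)`; hypothesis `hD1`), `ιV` onto, `3 ≤ n` — `rhoAtLine_isIrreducible_of_lemD1AsPrinted`
with `hfac := hfac_sChiD … (r.toFun ε)`; survival and unitarity are theorems.
[cite: Liu2021, Def. 4.11 (FJcycle.tex l. 2090–2096), App. D §D.1 Steps 1∕2∕3 (l. 5217∕5219∕5221), Lemma D.1 (l. 5227; (1) l. 5229)]
[cite: GelbartRogawski1991, §3.1 Prop. 3.1.1 p. 455 L1–3, Remark p. 457 L4–13] -/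
theorem rhoAt_restOfCharRep_isIrreducible_of_lemD1AsPrinted (h : exists_recordSystem) (F : CMField) [IsGalois ℚ F] (h6 : 6 ≤ Module.finrank ℚ F)
    (ι₁ : F →+* ℂ) (V : HermSpace3 F ι₁) (Φ : CMType F) {n : ℕ} (e : Fin 3 × Fin 1 ≃ Fin n) (dV : Fin 3 → F)
    (hdV : ∀ i, IsCMField.complexConj F (dV i) = dV i) (hdV0 : ∀ i, dV i ≠ 0)
    (ιV : (sec42DataOf h isoOf F ι₁ V Φ).G →*
      UnitaryGroup.finAdelic ↥(maximalRealSubfield F) F (IsCMField.complexConj F) 3 (Matrix.diagonal dV))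
    (δ' : F) (r : Rep ↥(maximalRealSubfield F) (imagUnitSq F))
    (μ : IdeleClassGroup F →ₜ* Circle) (hμ : IdeleClassGroup.IsConjugateSymplectic F μ) (hw : IdeleClassGroup.HasWeight F μ 1)
    (hιs : Function.Surjective ιV) (hn : 3 ≤ n)
    (i : (toThm418Data (sec42DataOf h isoOf F ι₁ V Φ) (restOfCharRep h F h6 ι₁ V Φ e dV hdV hdV0 ιV δ' r μ hμ hw)).AdmIndex)
    (hD1 : ∀ v : HeightOneSpectrum (𝓞 ↥(maximalRealSubfield F)), LemD1_1AsPrinted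
      (Def411WeilCarriers.localLemD1Data ↥(maximalRealSubfield F) F (IsCMField.complexConj F) 3 e (Matrix.diagonal dV)
        (complexConj_imagUnit F) (imagUnit_ne_zero F) (imagUnit_mul_self F) (realDiagonal_isSymm F dV hdV)
        (isUnit_det_realDiagonal F dV hdV hdV0) (realDiagonal_map F dV hdV).symm (r.toFun i.1.1)
        (OmegaChiSplitting.chiLocalSplittingsD F e dV hdV hdV0 (toHeckeCharacter F μ) ((isOscillatorChar_toHeckeCharacter_iff μ).mpr hμ)
          (r.toFun i.1.1))
        hn (localMu F (toHeckeCharacter F μ))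
        (fun v x => norm_localMu F (toHeckeCharacter F μ) v (isUnitary_toHeckeCharacter F μ) x)
        (continuous_localMu F (toHeckeCharacter F μ))
        (fun v t => localMu_toLocalRing_eq_one_iff F (toHeckeCharacter F μ) v ((isOscillatorChar_toHeckeCharacter_iff μ).mpr hμ) t)
        i.1.2.1
        (Def411WeilCarriers.norm_chi_eq_one ↥(maximalRealSubfield F) F (IsCMField.complexConj F)
          (Algebra.IsQuadraticExtension.finrank_eq_two ↥(maximalRealSubfield F) F)
          (UnitaryGroup.algEquiv_ne_one_of_apply_eq_neg ↥(maximalRealSubfield F) F (IsCMField.complexConj F) (complexConj_imagUnit F)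
            (imagUnit_ne_zero F)) i.1.2)
        i.1.2.2.1 v)) :
    ((toThm418Data (sec42DataOf h isoOf F ι₁ V Φ) (restOfCharRep h F h6 ι₁ V Φ e dV hdV hdV0 ιV δ' r μ hμ hw)).rhoAt i).IsIrreducible :=
  Def411WeilCarriers.rhoAtLine_isIrreducible_of_lemD1AsPrinted ↥(maximalRealSubfield F) F (IsCMField.complexConj F) 3 e
    (Matrix.diagonal dV) (complexConj_imagUnit F) (imagUnit_ne_zero F) (imagUnit_mul_self F) (realDiagonal_isSymm F dV hdV)
    (isUnit_det_realDiagonal F dV hdV hdV0) (realDiagonal_map F dV hdV).symm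
    (OmegaChiSplitting.hsChiD F e dV hdV hdV0 (toHeckeCharacter F μ) (isUnitary_toHeckeCharacter F μ)
      ((isOscillatorChar_toHeckeCharacter_iff μ).mpr hμ))
    (r.toFun i.1.1) i.1.2
    (OmegaChiSplitting.chiLocalSplittingsD F e dV hdV hdV0 (toHeckeCharacter F μ) ((isOscillatorChar_toHeckeCharacter_iff μ).mpr hμ)
      (r.toFun i.1.1))
    (ι := ιV) hιs
    (OmegaChiSplitting.hfac_sChiD F e dV hdV hdV0 (toHeckeCharacter F μ) (isUnitary_toHeckeCharacter F μ)
      ((isOscillatorChar_toHeckeCharacter_iff μ).mpr hμ) (r.toFun i.1.1))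
    hn (localMu F (toHeckeCharacter F μ))
    (fun v x => norm_localMu F (toHeckeCharacter F μ) v (isUnitary_toHeckeCharacter F μ) x)
    (continuous_localMu F (toHeckeCharacter F μ))
    (fun v t => localMu_toLocalRing_eq_one_iff F (toHeckeCharacter F μ) v ((isOscillatorChar_toHeckeCharacter_iff μ).mpr hμ) t)
    hD1

/-- **`ω(μ, ε, χ) ≠ 0`** at the representative rest — the Δ2 junction's `hnvD` shape (`Representation.IsIrreducible.nontrivial`).
[cite: Liu2021, Def. 4.11 (FJcycle.tex l. 2094–2096), App. D Lemma D.1 (1) (l. 5229)] -/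
theorem nontrivial_omegaAt_restOfCharRep_of_lemD1AsPrinted (h : exists_recordSystem) (F : CMField) [IsGalois ℚ F] (h6 : 6 ≤ Module.finrank ℚ F)
    (ι₁ : F →+* ℂ) (V : HermSpace3 F ι₁) (Φ : CMType F) {n : ℕ} (e : Fin 3 × Fin 1 ≃ Fin n) (dV : Fin 3 → F)
    (hdV : ∀ i, IsCMField.complexConj F (dV i) = dV i) (hdV0 : ∀ i, dV i ≠ 0)
    (ιV : (sec42DataOf h isoOf F ι₁ V Φ).G →*
      UnitaryGroup.finAdelic ↥(maximalRealSubfield F) F (IsCMField.complexConj F) 3 (Matrix.diagonal dV))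
    (δ' : F) (r : Rep ↥(maximalRealSubfield F) (imagUnitSq F))
    (μ : IdeleClassGroup F →ₜ* Circle) (hμ : IdeleClassGroup.IsConjugateSymplectic F μ) (hw : IdeleClassGroup.HasWeight F μ 1)
    (hιs : Function.Surjective ιV) (hn : 3 ≤ n)
    (i : (toThm418Data (sec42DataOf h isoOf F ι₁ V Φ) (restOfCharRep h F h6 ι₁ V Φ e dV hdV hdV0 ιV δ' r μ hμ hw)).AdmIndex)
    (hD1 : ∀ v : HeightOneSpectrum (𝓞 ↥(maximalRealSubfield F)), LemD1_1AsPrinted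
      (Def411WeilCarriers.localLemD1Data ↥(maximalRealSubfield F) F (IsCMField.complexConj F) 3 e (Matrix.diagonal dV)
        (complexConj_imagUnit F) (imagUnit_ne_zero F) (imagUnit_mul_self F) (realDiagonal_isSymm F dV hdV)
        (isUnit_det_realDiagonal F dV hdV hdV0) (realDiagonal_map F dV hdV).symm (r.toFun i.1.1)
        (OmegaChiSplitting.chiLocalSplittingsD F e dV hdV hdV0 (toHeckeCharacter F μ) ((isOscillatorChar_toHeckeCharacter_iff μ).mpr hμ)
          (r.toFun i.1.1))
        hn (localMu F (toHeckeCharacter F μ))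
        (fun v x => norm_localMu F (toHeckeCharacter F μ) v (isUnitary_toHeckeCharacter F μ) x)
        (continuous_localMu F (toHeckeCharacter F μ))
        (fun v t => localMu_toLocalRing_eq_one_iff F (toHeckeCharacter F μ) v ((isOscillatorChar_toHeckeCharacter_iff μ).mpr hμ) t)
        i.1.2.1
        (Def411WeilCarriers.norm_chi_eq_one ↥(maximalRealSubfield F) F (IsCMField.complexConj F)
          (Algebra.IsQuadraticExtension.finrank_eq_two ↥(maximalRealSubfield F) F)
          (UnitaryGroup.algEquiv_ne_one_of_apply_eq_neg ↥(maximalRealSubfield F) F (IsCMField.complexConj F) (complexConj_imagUnit F)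
            (imagUnit_ne_zero F)) i.1.2)
        i.1.2.2.1 v)) :
    Nontrivial ((toThm418Data (sec42DataOf h isoOf F ι₁ V Φ) (restOfCharRep h F h6 ι₁ V Φ e dV hdV hdV0 ιV δ' r μ hμ hw)).omegaAt i) :=
  haveI := rhoAt_restOfCharRep_isIrreducible_of_lemD1AsPrinted h F h6 ι₁ V Φ e dV hdV hdV0 ιV δ' r μ hμ hw hιs hn i hD1
  Representation.IsIrreducible.nontrivial
    ((toThm418Data (sec42DataOf h isoOf F ι₁ V Φ) (restOfCharRep h F h6 ι₁ V Φ e dV hdV hdV0 ιV δ' r μ hμ hw)).rhoAt i)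

end Rep

end Summit.HodgeConjecture.CorCM.Model

end
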